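import Summits.QuantumAdvantage.QuantumAdvantage.Theses.ModularRank
import Literature.Computability.QuantumComplexity.StabilizerRankOver

/-!
# Line `listing-plumbing` — item stmt-QuantumAdvantage-17858 (`ModularRank.DecomposerListingPolyTime`)

Skeleton registered by the crux-strategist (planner-cstrat-stmt-QuantumAdvantage-1792-r1-0,
2026-08-17; card `Lines/listing-plumbing.md`). The item is the COMPLEXITY-PLUMBING piece of the
split `ModularRankPoly ⟸ DenseModularDecomposer ∧ DecomposerListingPolyTime` (glue PROVED,
`Cruxes/ModularRankPoly/Split.lean`). It is TRUE; the line is its natural two-machine proof over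
the tree's TM2 `PolyTimeComputable`:

* `stub_supplyPolyTime` — the filtered PRIME SUPPLY `(t,k) ↦ [p < (t+k)^d + d : p prime,
  p ≡ 1 (mod 8), P t p]` is poly-time from unary `(t,k)` into the `foldr boolPair` list-of-`encodeNat`
  encoding, for every poly-time recogniser `P` (enumerate the range — poly(t+k) VALUES —, trial
  division, residue, one call of `P` per candidate on a unary argument of length `O(t + p)`).
* `stub_mapPolyTime` — MAP-OVER-A-SHORT-LIST: for every poly-time `E : (t,k) ↦ List ℕ` whose
  entries are VALUE-bounded by `(t+k)^d + d` and every poly-time per-prime map `F` on unary `(t,p)`,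
  the listing `(t,k) ↦ ⟨t, (E t k).map (p ↦ (p, F t p))⟩` is poly-time into `ModularRankPoly`'s
  output encoding (at most poly many calls of `F`, each on a poly-length unary input; re-encode).
* `DecomposerListingPolyTime_of` — the composition, a REAL proof: instantiate `E` with the supply
  (its entries lie in `range ((t+k)^d + d)`, `List.mem_range`).

Tree tools for the stubs: `PolyTimeComputable.comp_holds` (TimeBoundsProofs.lean:674),
`PolyTimeComputable.const` / `.id`, `of_encode_eq` / `of_output_eq` / `precomp` (NPBridge.lean,
RandomizedProofs.lean), `boolPair` API (BoolEncodings.lean). Neither stub mentions magic states: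
both are generic closure properties (the value bound in `stub_mapPolyTime` is what makes unary
calls affordable; without it the statement is false).
-/

set_option linter.dupNamespace false

namespace Summit.QuantumAdvantage.QuantumAdvantage.Cruxes.DecomposerListingPolyTime.ListingPlumbing

open Summit.QuantumAdvantage.QuantumAdvantage.Theses.ModularRank

/-! ## Registered stubs -/

/-- **stub 1 (prime supply is poly-time; M, TRUE)**: for every exponent `d` and every recogniser
`P` poly-time on unary `(t,p)` with Boolean output, the filtered list of candidates
`p < (t+k)^d + d` with `p` prime, `p ≡ 1 (mod 8)` and `P t p` is computable in polynomial time from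
unary `(t,k)`, output as `foldr boolPair []` of the `encodeNat`s. [cite: AroraBarak2009, §1.2–1.3] -/
theorem stub_supplyPolyTime :
    ∀ (d : ℕ) (P : ℕ → ℕ → Bool), Literature.Computability.Complexity.PolyTimeComputable (fun q : ℕ × ℕ => Literature.Computability.Complexity.boolPair (Computability.unaryEncodeNat q.1) (Computability.unaryEncodeNat q.2)) Computability.encodeBool (fun q => P q.1 q.2) → Literature.Computability.Complexity.PolyTimeComputable (fun q : ℕ × ℕ => Literature.Computability.Complexity.boolPair (Computability.unaryEncodeNat q.1) (Computability.unaryEncodeNat q.2)) (fun l : List ℕ => (l.map Computability.encodeNat).foldr Literature.Computability.Complexity.boolPair []) (fun q => (List.range ((q.1 + q.2) ^ d + d)).filter fun p => decide (p.Prime ∧ p % 8 = 1 ∧ P q.1 p = true)) := by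
  sorry

/-- **stub 2 (map over a short list of value-bounded entries is poly-time; M, TRUE)**: for every
`d`, every `E : (t,k) ↦ List ℕ` poly-time from unary `(t,k)` (list-of-`encodeNat` output) with all
entries `< (t+k)^d + d`, and every per-prime map `F` poly-time on unary `(t,p)`, the listing
`(t,k) ↦ ⟨t, (E t k).map (p ↦ (p, F t p))⟩` is poly-time into `ModularRankPoly`'s output encoding.
The value bound is essential (unary calls of `F` on an entry `p` cost `poly(t + p)`).
[cite: AroraBarak2009, §1.2–1.3] -/
theorem stub_mapPolyTime :
    ∀ (d : ℕ) (E : ℕ → ℕ → List ℕ) (F : (t : ℕ) → ℕ → ℕ × List (Literature.Computability.Cryptography.QCircuit Literature.Computability.Cryptography.cliffordT t × ℕ)), (∀ t k : ℕ, ∀ p ∈ E t k, p < (t + k) ^ d + d) → Literature.Computability.Complexity.PolyTimeComputable (fun q : ℕ × ℕ => Literature.Computability.Complexity.boolPair (Computability.unaryEncodeNat q.1) (Computability.unaryEncodeNat q.2)) (fun l : List ℕ => (l.map Computability.encodeNat).foldr Literature.Computability.Complexity.boolPair []) (fun q => E q.1 q.2) → Literature.Computability.Complexity.PolyTimeComputable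 (fun q : ℕ × ℕ => Literature.Computability.Complexity.boolPair (Computability.unaryEncodeNat q.1) (Computability.unaryEncodeNat q.2)) (fun o : (Σ t : ℕ, ℕ × List (Literature.Computability.Cryptography.QCircuit Literature.Computability.Cryptography.cliffordT t × ℕ)) => Literature.Computability.Complexity.boolPair (Computability.encodeNat o.1) (Literature.Computability.Complexity.boolPair (Computability.encodeNat o.2.1) ((o.2.2.map fun x => Literature.Computability.Complexity.boolPair x.1.encode (Computability.encodeNat x.2)).foldr Literature.Computability.Complexity.boolPair []))) (fun q => ⟨q.1, F q.1 q.2⟩) → Literature.Computability.Complexity.PolyTimeComputable (fun q : ℕ × ℕ => Literature.Computability.Complexity.boolPair (Computability.unaryEncodeNat q.1) (Computability.unaryEncodeNat q.2)) (fun o : (Σ t : ℕ, List (ℕ × ℕ × List (Literature.Computability.Cryptography.QCircuit Literature.Computability.Cryptography.cliffordT t × ℕ))) => Literature.Computability.Complexity.boolPair (Computability.encodeNat o.1) ((o.2.map fun b => Literature.Computability.Complexity.boolPair (Computability.encodeNat b.1) (Literature.Computability.Complexity.boolPair (Computability.encodeNat b.2.1) ((b.2.2.map fun x => Literature.Computability.Complexity.boolPair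 x.1.encode (Computability.encodeNat x.2)).foldr Literature.Computability.Complexity.boolPair []))).foldr Literature.Computability.Complexity.boolPair [])) (fun q => ⟨q.1, (E q.1 q.2).map fun p => (p, F q.1 p)⟩) := by
  sorry

/-! ## The composition (real proof) -/

/-- **The line closes the item**: supply ∧ map-over-short-list ⇒ `DecomposerListingPolyTime` (by
name). Instantiate `E` with the supply of stub 1; its entries lie in `range ((t+k)^d + d)`. -/
theorem DecomposerListingPolyTime_of
    (hSupply : ∀ (d : ℕ) (P : ℕ → ℕ → Bool), Literature.Computability.Complexity.PolyTimeComputable (fun q : ℕ × ℕ => Literature.Computability.Complexity.boolPair (Computability.unaryEncodeNat q.1) (Computability.unaryEncodeNat q.2)) Computability.encodeBool (fun q => P q.1 q.2) → Literature.Computability.Complexity.PolyTimeComputable (fun q : ℕ × ℕ => Literature.Computability.Complexity.boolPair (Computability.unaryEncodeNat q.1) (Computability.unaryEncodeNat q.2)) (fun l : List ℕ => (l.map Computability.encodeNat).foldr Literature.Computability.Complexity.boolPair []) (fun q => (List.range ((q.1 + q.2) ^ d + d)).filter fun p => decide (p.Prime ∧ p % 8 = 1 ∧ P q.1 p = tr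ue)))
    (hMap : ∀ (d : ℕ) (E : ℕ → ℕ → List ℕ) (F : (t : ℕ) → ℕ → ℕ × List (Literature.Computability.Cryptography.QCircuit Literature.Computability.Cryptography.cliffordT t × ℕ)), (∀ t k : ℕ, ∀ p ∈ E t k, p < (t + k) ^ d + d) → Literature.Computability.Complexity.PolyTimeComputable (fun q : ℕ × ℕ => Literature.Computability.Complexity.boolPair (Computability.unaryEncodeNat q.1) (Computability.unaryEncodeNat q.2)) (fun l : List ℕ => (l.map Computability.encodeNat).foldr Literature.Computability.Complexity.boolPair []) (fun q => E q.1 q.2) → Literature.Computability.Complexity.PolyTimeComputable (fun q : ℕ × ℕ => Literature.Computability.Complexity.boolPair (Computability.unaryEncodeNat q.1) (Computability.unaryEncodeNat q.2)) (fun o : (Σ t : ℕ, ℕ × List (Literature.Computability.Cryptography.QCircuit Literature.Computability.Cryptography.cliffordT t × ℕ)) => Literature.Computability.Complexity.boolPair (Computability.encodeNat o.1) (Literature.Computability.Complexity.boolPair (Computability.encodeNat o.2.1) ((o.2.2.map fun x => Literature.Computability.Complexity.boolPair x.1.encode (Computability.encodeNat x.2)).foldr Literature.Computability.Complexity.boolPair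 []))) (fun q => ⟨q.1, F q.1 q.2⟩) → Literature.Computability.Complexity.PolyTimeComputable (fun q : ℕ × ℕ => Literature.Computability.Complexity.boolPair (Computability.unaryEncodeNat q.1) (Computability.unaryEncodeNat q.2)) (fun o : (Σ t : ℕ, List (ℕ × ℕ × List (Literature.Computability.Cryptography.QCircuit Literature.Computability.Cryptography.cliffordT t × ℕ))) => Literature.Computability.Complexity.boolPair (Computability.encodeNat o.1) ((o.2.map fun b => Literature.Computability.Complexity.boolPair (Computability.encodeNat b.1) (Literature.Computability.Complexity.boolPair (Computability.encodeNat b.2.1) ((b.2.2.map fun x => Literature.Computability.Complexity.boolPair x.1.encode (Computability.encodeNat x.2)).foldr Literature.Computability.Complexity.boolPair []))).foldr Literature.Computability.Complexity.boolPair [])) (fun q => ⟨q.1, (E q.1 q.2).map fun p => (p, F q.1 p)⟩)) :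
    Summit.QuantumAdvantage.QuantumAdvantage.Theses.ModularRank.DecomposerListingPolyTime := by
  intro d P F hP hF
  have hE := hSupply d P hP
  have hbound : ∀ t k : ℕ, ∀ p ∈ ((List.range ((t + k) ^ d + d)).filter fun p =>
      decide (p.Prime ∧ p % 8 = 1 ∧ P t p = true)), p < (t + k) ^ d + d :=
    fun t k p hp => List.mem_range.1 (List.mem_filter.1 hp).1
  exact hMap d (fun t k => (List.range ((t + k) ^ d + d)).filter fun p =>
      decide (p.Prime ∧ p % 8 = 1 ∧ P t p = true)) F hbound hE hF

/-- The piece from the two stubs, by the composition (closed modulo the stub `sorry`s; this is the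
theorem the skeleton registry keys on). -/
theorem decomposerListingPolyTime_holds_of_stubs :
    Summit.QuantumAdvantage.QuantumAdvantage.Theses.ModularRank.DecomposerListingPolyTime :=
  DecomposerListingPolyTime_of stub_supplyPolyTime stub_mapPolyTime

end Summit.QuantumAdvantage.QuantumAdvantage.Cruxes.DecomposerListingPolyTime.ListingPlumbing
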